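import Summits.Schanuel.Schanuel.Theorems.RootDecomp1KOnePointCell09

/-!
# RootDecomp1KOnePointCell — lens 1, generation 39 «ONE-POINT ZERO ESTIMATE + LOG-LOG WALL CELL of 33364» ((1, ℓ₂, ℓ₃, ρ) for every log-log-Liouville ρ) — continuation (RootDecomp1KOnePointCell10): §6 separation from g38's measured wall: `wall_param_eq_of_range_eq`, `zP_not_inMeasuredWallClass`, `rhoE_ne_ellT`, `range_zP_ne_range_zM`, `range_zP_ne_range_zE`

(lens-1 g39 `RootDecomp1KOnePointCell.lean` [HOME/decomp-schanuel-lens-1/g39/RootDecomp1KOnePointCell.lean sha256 4a1f4bc8…4211, 2530 l + OPprobe + OPctrl + NODE-g39.md; NOTE/CLAIM L1801, ACK + CHECKLIST K-g39 L1803, presearch (6) resolved by the critic L1810, NODE L1824 / REQUEST L1825 / RESULT L1826]; port by census-1 gen 16 in ten parts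
`RootDecomp1KOnePointCell01`–`10` — see the PORT NOTE of part 01; `--supports stmt-Schanuel-33364`; rung 0.)
-/

open Complex IntermediateField Polynomial
open Summit.Schanuel.Schanuel.Theorems.RootDecomp1KHyper
open Summit.Schanuel.Schanuel.Theorems.RootDecomp1KHyper.HyperCell
open Summit.Schanuel.Schanuel.Theorems.RootDecomp1KGeneric
open Summit.Schanuel.Schanuel.Theorems.RootDecomp1KRelLiouvilleCell
open Summit.Schanuel.Schanuel.Theorems.RootDecomp1KLogLogCell
open Summit.Schanuel.Schanuel.Theorems.RootDecomp1KTwoBaseCell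
open Summit.Schanuel.Schanuel.Theorems.RootDecomp1KMeasuredWallCell

namespace Summit.Schanuel.Schanuel.Theorems.RootDecomp1KOnePointCell

section Member
open LiouvilleNumber
open scoped Nat

/-! ### Separation from g38's measured wall: `z_P` is in NO measured-wall class, and `ρ_E ≠ ℓ_T` -/

/-- **Range injectivity of the wall parameter.** If `ρ ∉ {1, ℓ₂, ℓ₃}` and the wall tuples `(1, ℓ₂, ℓ₃, ρ)` and
`(1, ℓ₂, ℓ₃, ρ')` have the same range, then `ρ' = ρ`. -/
theorem wall_param_eq_of_range_eq {ρ ρ' : ℝ} (h1 : (ρ : ℂ) ≠ 1) (h2 : (ρ : ℂ) ≠ ((liouvilleNumber 2 : ℝ) : ℂ))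
    (h3 : (ρ : ℂ) ≠ ((liouvilleNumber 3 : ℝ) : ℂ))
    (h : Set.range ![(1 : ℂ), ((liouvilleNumber 2 : ℝ) : ℂ), ((liouvilleNumber 3 : ℝ) : ℂ), (ρ : ℂ)] =
      Set.range ![(1 : ℂ), ((liouvilleNumber 2 : ℝ) : ℂ), ((liouvilleNumber 3 : ℝ) : ℂ), (ρ' : ℂ)]) :
    ρ' = ρ := by
  have hmem : (ρ : ℂ) ∈
      Set.range ![(1 : ℂ), ((liouvilleNumber 2 : ℝ) : ℂ), ((liouvilleNumber 3 : ℝ) : ℂ), (ρ' : ℂ)] := by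
    rw [← h]; exact ⟨3, rfl⟩
  obtain ⟨i, hi⟩ := hmem
  fin_cases i
  · exact absurd hi.symm h1
  · exact absurd hi.symm h2
  · exact absurd hi.symm h3
  · have hi' : (ρ' : ℂ) = (ρ : ℂ) := by simpa using hi
    exact_mod_cast hi'

/-- The π-twin: same ranges of `(π, πℓ₂, πℓ₃, πρ)` and `(π, πℓ₂, πℓ₃, πρ')` with `ρ ∉ {1, ℓ₂, ℓ₃}` force
`ρ' = ρ`. -/
theorem wall_param_eq_of_range_eq_pi {ρ ρ' : ℝ} (h1 : (ρ : ℂ) ≠ 1)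
    (h2 : (ρ : ℂ) ≠ ((liouvilleNumber 2 : ℝ) : ℂ)) (h3 : (ρ : ℂ) ≠ ((liouvilleNumber 3 : ℝ) : ℂ))
    (h : Set.range ![(Real.pi : ℂ), (Real.pi : ℂ) * ((liouvilleNumber 2 : ℝ) : ℂ),
        (Real.pi : ℂ) * ((liouvilleNumber 3 : ℝ) : ℂ), (Real.pi : ℂ) * (ρ : ℂ)] =
      Set.range ![(Real.pi : ℂ), (Real.pi : ℂ) * ((liouvilleNumber 2 : ℝ) : ℂ),
        (Real.pi : ℂ) * ((liouvilleNumber 3 : ℝ) : ℂ), (Real.pi : ℂ) * (ρ' : ℂ)]) :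
    ρ' = ρ := by
  have hπ0 : (Real.pi : ℂ) ≠ 0 := by exact_mod_cast Real.pi_ne_zero
  have hmem : (Real.pi : ℂ) * (ρ : ℂ) ∈
      Set.range ![(Real.pi : ℂ), (Real.pi : ℂ) * ((liouvilleNumber 2 : ℝ) : ℂ),
        (Real.pi : ℂ) * ((liouvilleNumber 3 : ℝ) : ℂ), (Real.pi : ℂ) * (ρ' : ℂ)] := by
    rw [← h]; exact ⟨3, rfl⟩
  obtain ⟨i, hi⟩ := hmem
  fin_cases i
  · refine absurd ?_ h1
    have hi' : (Real.pi : ℂ) * 1 = (Real.pi : ℂ) * (ρ : ℂ) := by simpa using hi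
    exact (mul_left_cancel₀ hπ0 hi').symm
  · refine absurd ?_ h2
    have hi' : (Real.pi : ℂ) * ((liouvilleNumber 2 : ℝ) : ℂ) = (Real.pi : ℂ) * (ρ : ℂ) := by simpa using hi
    exact (mul_left_cancel₀ hπ0 hi').symm
  · refine absurd ?_ h3
    have hi' : (Real.pi : ℂ) * ((liouvilleNumber 3 : ℝ) : ℂ) = (Real.pi : ℂ) * (ρ : ℂ) := by simpa using hi
    exact (mul_left_cancel₀ hπ0 hi').symm
  · have hi' : (Real.pi : ℂ) * (ρ' : ℂ) = (Real.pi : ℂ) * (ρ : ℂ) := by simpa using hi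
    exact_mod_cast mul_left_cancel₀ hπ0 hi'

/-- `ρ_E ≠ 1` (indeed `ρ_E < 1`). -/
theorem rhoE_ne_one_complex : ((rhoE : ℝ) : ℂ) ≠ 1 := by
  intro h
  have h' : rhoE = 1 := by exact_mod_cast h
  linarith [rhoE_lt_one]

/-- `ρ_E ≠ ℓ₂`, as complex numbers. -/
theorem rhoE_ne_ell_two_complex : ((rhoE : ℝ) : ℂ) ≠ ((liouvilleNumber 2 : ℝ) : ℂ) := fun h =>
  rhoE_ne_liouvilleNumber (b := 2) (by norm_num) (by exact_mod_cast h)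

/-- `ρ_E ≠ ℓ₃`, as complex numbers. -/
theorem rhoE_ne_ell_three_complex : ((rhoE : ℝ) : ℂ) ≠ ((liouvilleNumber 3 : ℝ) : ℂ) := fun h =>
  rhoE_ne_liouvilleNumber (b := 3) (by norm_num) (by exact_mod_cast h)

/-- **`z_P` is in NO measured-wall class of g38** (`InMeasuredWallClass`, parameter `ρ` log-HYPER-Liouville):
equal ranges force `ρ = ρ_E` (`wall_param_eq_of_range_eq`), and `ρ_E` is NOT log-hyper-Liouville
(`not_logHyperLiouville_rhoE`, tree: `ρ_E` is not even log-square-Liouville).  So the g39 cell is STRICTLY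
larger than g38's, with `z_P` a witness of the difference. -/
theorem zP_not_inMeasuredWallClass : ¬ InMeasuredWallClass zP := by
  rintro ⟨ρ, hρ, hr⟩
  have e : ρ = rhoE :=
    wall_param_eq_of_range_eq rhoE_ne_one_complex rhoE_ne_ell_two_complex rhoE_ne_ell_three_complex hr
  exact not_logHyperLiouville_rhoE (e ▸ hρ)

/-- π-twin: `z_P^π` is in no measured-wall π-class of g38. -/
theorem zPpi_not_inMeasuredWallClassPi : ¬ InMeasuredWallClassPi zPpi := by
  rintro ⟨ρ, hρ, hr⟩
  have e : ρ = rhoE :=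
    wall_param_eq_of_range_eq_pi rhoE_ne_one_complex rhoE_ne_ell_two_complex rhoE_ne_ell_three_complex hr
  exact not_logHyperLiouville_rhoE (e ▸ hρ)

/-- `ρ_E ≠ ℓ_T` (g38's member parameter): `ℓ_T` is log-hyper-Liouville, `ρ_E` is not. -/
theorem rhoE_ne_ellT : rhoE ≠ ellT := fun h =>
  not_logHyperLiouville_rhoE (by rw [h]; exact logHyperLiouville_ellT)

/-- `z_P ≠ z_M` as cells: their ranges differ (`ρ_E ≠ ℓ_T`). -/
theorem range_zP_ne_range_zM : Set.range zP ≠ Set.range zM := fun h =>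
  rhoE_ne_ellT (wall_param_eq_of_range_eq rhoE_ne_one_complex rhoE_ne_ell_two_complex
    rhoE_ne_ell_three_complex h).symm

/-- π-twin: `range z_P^π ≠ range z_M^π`. -/
theorem range_zPpi_ne_range_zMpi : Set.range zPpi ≠ Set.range zMpi := fun h =>
  rhoE_ne_ellT (wall_param_eq_of_range_eq_pi rhoE_ne_one_complex rhoE_ne_ell_two_complex
    rhoE_ne_ell_three_complex h).symm

/-- `z_P` is not (a re-indexing of) the log-log cell member `z_E = (1, ℓ₂, ρ_E)` of g35 either (a `Fin 3` range). -/
theorem range_zP_ne_range_zE : Set.range zP ≠ Set.range zE := range_zP_ne_range_fin_three _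

end Member

end Summit.Schanuel.Schanuel.Theorems.RootDecomp1KOnePointCell
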